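import Mathlib.Analysis.SpecialFunctions.Pow.Real
import Mathlib.Algebra.Order.Floor.Defs
import Literature.Probability.Percolation.Percolation
import HarnessLib

/-!
# Cerf 2015: long-range order in a finite box from `θ(p) > 0` (site percolation on `ℤ^d`)

Topic `Literature/Probability/Percolation`. Named fact vendored for route `PercFiniteBoxLRO` of
`CriticalPhenomena/PercolationContinuityZ3` (support item `stmt-CriticalPhenomena-0860`
`Cerf2015BoxLRO16`; cruxes `PolyScaleLROOfTheta`, `LinearScaleLROOfTheta` sharpen it).

R. Cerf, *A lower bound on the two-arms exponent for critical percolation on the lattice*,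
Ann. Probab. 43 (2015) 2458–2480, arXiv:1306.3105, works with SITE percolation on `ℤ^d`
(p. 1: "We consider the site percolation model on `ℤ^d`. Each site is declared open with
probability `p` …") and proves, "starting only with the hypothesis that `θ(p) > 0`, without using
the slab technology", finite-box long-range order at a polynomial scale:

> **Theorem 1.3.** Let `d ≥ 2` and let `p` be such that `θ(p) > 0`. Let `α` be such that
> `α > (4d² + 5d − 5)(3d − 1) / (2d² + 3d − 3)`. We have
> `inf_{n ≥ 1} inf { P_p(x ⟷ y in Λ(n^α)) : x, y ∈ Λ(n) } > 0`.
> For `d = 3`, this gives: `∃ ρ > 0, ∀ n ≥ 1, ∀ x, y ∈ Λ(n), P_p(x ⟷ y in Λ(n^16)) ≥ ρ`.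

Here `Λ(n) = [−n, n]^d`, `{x ⟷ y in Λ}` is "joined by an open path inside `Λ`" (p. 4) and
`θ(p) = P_p(|C(0)| = ∞)`. Cerf adds (p. 5): "it would be enough to have the above estimate within
a box of side length proportional to `n`" for the renormalisation argument towards `θ(p_c) = 0`.

## Tree formulation and faithfulness

* Site percolation on `ℤ^d`: `sitePercolation (Site d) p`, clusters/connection events of the
  nearest-neighbour graph `zdGraph d` (`siteConnIn`, `siteTheta`, `Percolation.lean`); boxes
  `box d n = {−n,…,n}^d` (`ThermodynamicLimit.lean`).
* `Λ(n^α)` for real `n^α` is rendered as `box d ⌈n^α⌉₊ ⊇ Λ(n^α)`; the connection event is monotone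
  in the box, so the vendored inequality is implied by the printed one. In the `d = 3` clause the
  box is `box 3 (n ^ 16)` exactly as printed.
* The route decl `Cerf2015BoxLRO16` is the same statement for BOND percolation
  (`bondPercolation (zdGraph 3)`, `openConnIn`, `theta`); that transcription is NOT in the paper
  (the Aizenman–Kesten–Newman / Gandolfi–Grimmett–Russo argument it reworks is model-robust, but
  Cerf's text is site-only), so the bond item is this fact ∘ (site → bond rewrite of §§3–7), not an
  instantiation.

Mathlib / tree search: no arm exponents or AKN-type estimates anywhere (`lean search
'two.?arms|Cerf|Aizenman.?Kesten'`: docstrings only).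

## Source

R. Cerf, Ann. Probab. 43 (2015), no. 5, 2458–2480, doi:10.1214/14-AOP940, arXiv:1306.3105:
Theorem 1.3 (p. 4 of the arXiv version), with Theorems 1.1–1.2 (two-arms exponent bounds) as
its inputs.
-/

noncomputable section

open MeasureTheory Literature.Probability.LatticeModels Literature.Probability.Percolation

namespace Literature.Probability.Percolation

section CritPerc

/-- **Cerf's finite-box long-range order from `θ(p) > 0` (site percolation on `ℤ^d`, general
`d ≥ 2`).** Cerf 2015, Theorem 1.3: "Let `d ≥ 2` and let `p` be such that `θ(p) > 0`. Let `α` be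
such that `α > (4d² + 5d − 5)(3d − 1)/(2d² + 3d − 3)`. We have
`inf_{n≥1} inf{P_p(x ⟷ y in Λ(n^α)) : x, y ∈ Λ(n)} > 0`." Rendered with `Λ(n^α) ↦ box d ⌈n^α⌉₊`
(a larger box, weaker event bound — implied by the printed statement).
[cite: Cerf2015, Thm 1.3] -/
def Cerf2015_thm_1_3 : Prop :=
  ∀ d : ℕ, 2 ≤ d → ∀ p : unitInterval, 0 < siteTheta (zdGraph d) 0 p →
    ∀ α : ℝ, ((4 * (d : ℝ) ^ 2 + 5 * d - 5) * (3 * d - 1)) / (2 * (d : ℝ) ^ 2 + 3 * d - 3) < α →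
      ∃ ρ : ℝ, 0 < ρ ∧ ∀ n : ℕ, 1 ≤ n → ∀ x ∈ box d n, ∀ y ∈ box d n,
        ρ ≤ (sitePercolation (Site d) p).real
          (siteConnIn (zdGraph d) ↑(box d ⌈(n : ℝ) ^ α⌉₊) x y)

/-- **Cerf's finite-box long-range order, `d = 3`** (Cerf 2015, Theorem 1.3, displayed
consequence: "For `d = 3`, this gives the following estimate:
`∃ ρ > 0, ∀ n ≥ 1, ∀ x, y ∈ Λ(n), P_p(x ⟷ y in Λ(n^16)) ≥ ρ`", for site percolation on `ℤ³`
with `θ(p) > 0`). Grounds — modulo the site → bond transcription, which is not in print —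
`Summit.CriticalPhenomena.PercolationContinuityZ3.Theses.PercFiniteBoxLRO.Cerf2015BoxLRO16`.
[cite: Cerf2015, Thm 1.3 (case d = 3)] -/
def Cerf2015_thm_1_3_three : Prop :=
  ∀ p : unitInterval, 0 < siteTheta (zdGraph 3) 0 p →
    ∃ ρ : ℝ, 0 < ρ ∧ ∀ n : ℕ, 1 ≤ n → ∀ x ∈ box 3 n, ∀ y ∈ box 3 n,
      ρ ≤ (sitePercolation (Site 3) p).real (siteConnIn (zdGraph 3) ↑(box 3 (n ^ 16)) x y)

end CritPerc

end Literature.Probability.Percolation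

/-! ## The case `d = 3` from the general statement -/

namespace Literature.Probability.Percolation

section CritPerc

/-- For a natural number `n`, the real power `n ^ (16 : ℝ)` is the natural number `n ^ 16`, so
its natural ceiling is `n ^ 16`. (Arithmetic glue between the `⌈n^α⌉₊` box of
`Cerf2015_thm_1_3` and the `n ^ 16` box of `Cerf2015_thm_1_3_three`.) [folklore] -/
theorem natCeil_natCast_rpow_sixteen (n : ℕ) : ⌈(n : ℝ) ^ (16 : ℝ)⌉₊ = n ^ 16 := by
  have : (n : ℝ) ^ (16 : ℝ) = ((n ^ 16 : ℕ) : ℝ) := by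
    rw [show (16 : ℝ) = ((16 : ℕ) : ℝ) by norm_num, Real.rpow_natCast]
    push_cast; rfl
  rw [this, Nat.ceil_natCast]

/-- **Cerf 2015, Theorem 1.3, `d = 3` from the general case.** The displayed `d = 3` estimate of
Cerf's Theorem 1.3 ("For `d = 3`, this gives …", arXiv p. 3) is the instance `d = 3`, `α = 16` of
the general statement: the threshold is `(4·9 + 15 − 5)(9 − 1)/(18 + 9 − 3) = 368/24 = 46/3 < 16`,
and `Λ(⌈n^16⌉) = Λ(n^16)`. Hence the `d = 3` named fact is fed by the general one.
[cite: Cerf2015, Thm 1.3 (case d = 3)] -/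
theorem Cerf2015_thm_1_3_three_of_thm_1_3 (h : Cerf2015_thm_1_3) : Cerf2015_thm_1_3_three := by
  intro p hp
  have hα : ((4 * ((3 : ℕ) : ℝ) ^ 2 + 5 * (3 : ℕ) - 5) * (3 * (3 : ℕ) - 1)) /
      (2 * ((3 : ℕ) : ℝ) ^ 2 + 3 * (3 : ℕ) - 3) < (16 : ℝ) := by norm_num
  obtain ⟨ρ, hρ, H⟩ := h 3 (by norm_num) p hp 16 hα
  refine ⟨ρ, hρ, fun n hn x hx y hy => ?_⟩
  have := H n hn x hx y hy
  rwa [natCeil_natCast_rpow_sixteen] at this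

end CritPerc

end Literature.Probability.Percolation
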